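import Literature.NumberTheory.LFunctions.LevinsonMethodMollifier
import HarnessLib

/-!
# `κ > 5/12` ⇐ the mollified mean square of Pratt–Robles–Zaharescu–Zeindler (fact split)

Topic `Literature/NumberTheory/LFunctions`. Fact-decomposition file (librarian, mode
`fact-decompose`, 2026-08-16) for the named fact `Literature.NumberTheory.LFunctions.przz_bound`
(`ZeroCounting.lean`; K. Pratt, N. Robles, A. Zaharescu, D. Zeindler, *More than five-twelfths of
the zeros of `ζ` are on the critical line*, Res. Math. Sci. 7 (2020) = arXiv:1802.10521, Thm. 1.1:
`κ > 5/12`).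

The tree has PROVED Levinson's method in Conrey's form — `κ ≥ 1 − (1/R) log c` from a mollified
mean square `∫_T^{2T} |ψV(σ₀ + it)|² ≤ (c + ε)T` (`levinson_criticalLineProportion_ge`,
`LevinsonMethodConditional.lean`; Littlewood's lemma, the auxiliary function `V = conreyV Q L`
built from Siegel's exact formula, the arithmetic–geometric mean step) — and that every
Dirichlet-polynomial mollifier family is admissible (`dirichletPolynomial_mollifier_conditions`),
assembled as `przz_bound_of_mollified_meanSquare` (`LevinsonMethodMollifier.lean`): the named fact
from the mean square for SOME admissible data `(Q, R, ψ)` with constant `c` satisfying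
`5/12 < 1 − (log c)/R`.  This file NAMES that remaining input (`PRZZ2020_mollified_meanSquare`,
the data and hypotheses of `przz_bound_of_mollified_meanSquare` bundled into one existential)
and records the PROVED assembly `przz_bound_holds_of`.

In print the child is **Theorem 1.3** (the asymptotic for the mean square of `Vψ` with the
three-piece mollifier `ψ = ψ₁ + ψ₂ + ψ₃` of length `θ = 4/7 − ε`; main terms from Thms. 4.1 and
7.1 via the autocorrelation-of-ratios technology and the Kloosterman-sum input for `θ < 4/7`)
together with the **numerical evaluation of §8** (`R = 1.3036`, the printed `P₁, P₂, P₃, Q`: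
`1 − (log c)/R → 0.417293962 > 5/12` as `ε → 0`).  It is a statement about a second moment of
`ζ` — not a restatement of the zero-proportion statement `κ > 5/12`; `k = 1` because Levinson's
deduction is a theorem of the tree.  CAVEAT carried over from `LevinsonMethodMollifier.lean`: the
tree's `V = conreyV Q (log T)` is Conrey's exact-identity variant of PRZZ's `Q(−L⁻¹ d/ds)ζ`; the
mean value theorem has to be run for this `V` (same main term).

## References

* K. Pratt, N. Robles, A. Zaharescu, D. Zeindler, Res. Math. Sci. 7 (2020), arXiv:1802.10521:
  Thm. 1.1, Thm. 1.3, Thms. 4.1, 7.1, §8. [PrattRoblesZaharescuZeindler2020]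
* J. B. Conrey, J. Number Theory 16 (1983) 49–74, §4. [Conrey1983]
-/

noncomputable section

open Complex Polynomial Set Filter Topology Metric MeasureTheory intervalIntegral Asymptotics
open scoped Real ComplexConjugate

namespace Literature.NumberTheory.LFunctions

open Literature.Analysis.Complex SiegelIntegral

/-- **Pratt–Robles–Zaharescu–Zeindler 2020, Thm. 1.3 with §8 (the mollified mean square beating
`5/12`), in the Levinson–Conrey frame of the tree.** There exist: a real polynomial `Q` with
`Q(x) + Q(1 − x) = c₀ ≠ 0` and `Q(0) = 1`; a shift `R > 0`; a Dirichlet-polynomial mollifier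
family `ψ_T(s) = ∑_{n ≤ N_T} a_T(n) n^{−s}` with `a_T(1) = 1`, `|a_T(n)| ≤ A n^κ` and
`1 ≤ N_T ≤ T^θ` eventually; and a constant `c_ms ≥ 1` such that (i) for every `ε > 0`,
eventually in `T`, `∫_T^{2T} |ψ_T(a_T + it) V_T(a_T + it)|² dt ≤ (c_ms + ε) T`, where
`a_T = ½ − R/log T` and `V_T = conreyV Q (log T)` (Conrey's auxiliary function), and (ii)
`5/12 < 1 − (log c_ms)/R`.  Printed: Thm. 1.3 gives `(1/T)∫_1^T |Vψ(σ₀+it)|² dt ∼ c(P, Q, R, θ)`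
for the mollifier `ψ = ψ₁ + ψ₂ + ψ₃` of (1.10)–(1.12) with `θ = 4/7 − ε` (main terms: Thm. 4.1
for the Feng cross-terms, Thm. 7.1 for the new two-piece terms), and §8 evaluates, for
`R = 1.3036`, `d = 1`, `K = 3` and the printed `P₁, P₂, P₃, Q`, "letting `ε → 0` yields
`κ ≥ 0.417293962`", i.e. `1 − (log c)/R > 5/12` for all small `ε > 0`.  These are exactly the
hypotheses of the tree's `przz_bound_of_mollified_meanSquare`, bundled into one existential.
[cite: PrattRoblesZaharescuZeindler2020, Thm. 1.3 and §8 (R = 1.3036, κ ≥ 0.417293962)] -/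
def PRZZ2020_mollified_meanSquare : Prop :=
  ∃ (Q : ℝ[X]) (c : ℝ) (_ : Q + Q.comp (1 - X) = C c) (_ : c ≠ 0) (_ : Q.coeff 0 = 1)
    (R : ℝ) (_ : 0 < R) (a : ℝ → ℕ → ℂ) (N : ℝ → ℕ) (A κ θ : ℝ) (_ : 0 ≤ A) (_ : 0 ≤ κ)
    (_ : ∀ᶠ T : ℝ in atTop, 1 ≤ N T ∧ (N T : ℝ) ≤ T ^ θ)
    (_ : ∀ T : ℝ, ∀ n : ℕ, ‖a T n‖ ≤ A * (n : ℝ) ^ κ) (_ : ∀ T : ℝ, a T 1 = 1)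
    (cms : ℝ) (_ : 1 ≤ cms),
    (∀ ε > 0, ∀ᶠ T : ℝ in atTop,
      ∫ t in T..2 * T, ‖(∑ n ∈ Finset.Icc 1 (N T),
          a T n * (n : ℂ) ^ (-((((1 / 2 - R / Real.log T : ℝ)) : ℂ) + t * I))) *
        conreyV Q (Real.log T) (((1 / 2 - R / Real.log T : ℝ) : ℂ) + t * I)‖ ^ 2 ≤ (cms + ε) * T) ∧
    (5 / 12 : ℝ) < 1 - Real.log cms / R

/-- **Assembly (fact split): `przz_bound` (`κ > 5/12`) from the mollified mean square** — unpack
the data and apply the tree's `przz_bound_of_mollified_meanSquare` (Levinson's method in Conrey's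
form, proved). [cite: PrattRoblesZaharescuZeindler2020, Thm. 1.1 from Thm. 1.3 and §8] -/
theorem przz_bound_holds_of (h : PRZZ2020_mollified_meanSquare) : przz_bound := by
  obtain ⟨Q, c, hQ, hc, hQ1, R, hR, a, N, A, κ, θ, hA, hκ, hN, ha, ha1, cms, hcms, hms, hnum⟩ := h
  exact przz_bound_of_mollified_meanSquare hQ hc hQ1 hR a N hA hκ hN ha ha1 hcms hms hnum

end Literature.NumberTheory.LFunctions

end
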